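import Mathlib
import HarnessLib
import Summits.AtomisticToContinuum.Crystallization.Theorems.HolmgrenBoyleLindHalfSpaceUniqueContinuationHorizontalModeLaplace
import Summits.AtomisticToContinuum.Crystallization.Theorems.HolmgrenBoyleLindHalfSpaceUniqueContinuationThickColumnModes

/-!
# Route `HolmgrenBoyleLind`: Lennard-Jones force fields of separated sources, part 20b —
THICK-COLUMN RIGIDITY II: a clean column kills the weighted shell sums of the horizontal modes

Support file for the crux item stmt-AtomisticToContinuum-6075 (`HalfSpaceUniqueContinuation`, line
`registered`, layered core; written by lead c3). Continues part 20a with the HORIZONTAL components: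

* **`hbl_hshells_eq_zero_of_column'`** (+ registered `∀`-form `hbl_hshells_eq_zero_of_column`) —
  if the component along a non-zero horizontal `c ∈ W` of the signed field vanishes along the open
  column `b₀ + (a − X) u`, `X > X₁`, then for `k ≠ 0` and every height fibre the
  `e_{k'}(b₀) ⟪c, w_{k'}⟫`-weighted sum over the shell `‖w_{k'}‖ = ‖w_k‖` of the signed structure
  factors vanishes: the horizontal profiles of part 19 (`hbl_fourier_horizontalSlice(_zero)`),
  divided by `−πi‖c‖` and with the real weights `⟪c, w_k⟫ / (‖c‖ ‖w_k‖) ∈ [−1, 1]` absorbed into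
  the phases, are the hypothesis of the shell-peeling core (part 18) with `ν = (2, 5)`,
  `a(r) = r (π/6)(πr)²`, `b(r) = −r (π/720)(πr)⁵`, `c₀ = 0`, `A = π⁶`.
All `[folklore]`; nothing here closes an item.
-/

noncomputable section

namespace Summit.AtomisticToContinuum.Crystallization.Theorems.HolmgrenBoyleLind

open scoped BigOperators Topology InnerProductSpace RealInnerProductSpace FourierTransform
open MeasureTheory Filter Set Literature.Algebra.EuclideanLattices.LatticePeriodic
  Literature.Analysis.SpecialFunctions
open scoped Classical

section Column

variable {u : EuclideanSpace ℝ (Fin 3)} (hu : ‖u‖ = 1) (Λ : Submodule ℤ (ℝ ∙ u)ᗮ)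
  [DiscreteTopology Λ] [IsZLattice ℝ Λ] {Dp Dm : Set (EuclideanSpace ℝ (Fin 3))} {δ a : ℝ}
  (hδ : 0 < δ) (hdisj : Disjoint Dp Dm)
  (hsepp : ∀ x ∈ Dp, ∀ y ∈ Dp, x ≠ y → δ ≤ dist x y)
  (hsepm : ∀ x ∈ Dm, ∀ y ∈ Dm, x ≠ y → δ ≤ dist x y)
  (hap : ∀ y ∈ Dp, a ≤ ⟪y, u⟫) (ham : ∀ y ∈ Dm, a ≤ ⟪y, u⟫)
  (hDp : ∀ ℓ : Λ, ∀ y : EuclideanSpace ℝ (Fin 3),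
    y + ((ℓ : (ℝ ∙ u)ᗮ) : EuclideanSpace ℝ (Fin 3)) ∈ Dp ↔ y ∈ Dp)
  (hDm : ∀ ℓ : Λ, ∀ y : EuclideanSpace ℝ (Fin 3),
    y + ((ℓ : (ℝ ∙ u)ᗮ) : EuclideanSpace ℝ (Fin 3)) ∈ Dm ↔ y ∈ Dm)


set_option maxHeartbeats 1600000 in
include hu hδ hsepp hsepm hap ham hDp hDm in
/-- **A clean column kills the weighted shell sums of the horizontal modes.** If the component
along a non-zero horizontal vector `c` of the signed field vanishes at every point `b₀ + (a − X) u`,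
`X > X₁ > 0`, then for every non-zero frequency `k` and every height fibre `T`, the
`e_{k'}(b₀) ⟪c, w_{k'}⟫`-weighted sum over the shell `‖w_{k'}‖ = ‖w_k‖` of the signed structure
factors vanishes (mode expansion of part 14, horizontal profiles of part 19, shell peeling of
part 18 with `c₀ = 0` and the weights `⟪c, w_k⟫/(‖c‖‖w_k‖)` absorbed into `θ`). [folklore] -/
theorem hbl_hshells_eq_zero_of_column' (b₀ : (ℝ ∙ u)ᗮ) (c : (ℝ ∙ u)ᗮ) (hc : c ≠ 0) {X₁ : ℝ}
    (hX₁ : 0 < X₁)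
    (hcol : ∀ X : ℝ, X₁ < X →
      (∑' yy : ↥(Dp ∪ Dm), (if (yy : EuclideanSpace ℝ (Fin 3)) ∈ Dp then (1 : ℂ) else -1) *
        ((⟪(c : EuclideanSpace ℝ (Fin 3)),
            ((((‖((b₀ : EuclideanSpace ℝ (Fin 3)) + (a - X) • u) - (yy : EuclideanSpace ℝ (Fin 3))‖ ^ 2) ^ 4)⁻¹ -
            ((‖((b₀ : EuclideanSpace ℝ (Fin 3)) + (a - X) • u) - (yy : EuclideanSpace ℝ (Fin 3))‖ ^ 2) ^ 7)⁻¹) •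
              (((b₀ : EuclideanSpace ℝ (Fin 3)) + (a - X) • u) - (yy : EuclideanSpace ℝ (Fin 3))))⟫ : ℝ) : ℂ)) = 0) :
    ∀ (k : Fin (Module.finrank ℝ (ℝ ∙ u)ᗮ) → ℤ), k ≠ 0 → ∀ (η : ℝ)
      (T : Finset {q : EuclideanSpace ℝ (Fin 3) //
        q ∈ Dp ∪ Dm ∧ (ℝ ∙ u)ᗮ.orthogonalProjectionOnto q ∈ fdom Λ}),
      (∀ q, q ∈ T ↔ ⟪(q : EuclideanSpace ℝ (Fin 3)), u⟫ = η) →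
      ∑ k' ∈ (finite_norm_dualVec_le Λ ‖dualVec Λ k‖).toFinset with ‖dualVec Λ k'‖ = ‖dualVec Λ k‖,
        echar Λ k' b₀ * ((⟪c, dualVec Λ k'⟫ : ℝ) : ℂ) *
          ∑ q ∈ T, (if ((q : EuclideanSpace ℝ (Fin 3)) ∈ Dp) then (1 : ℂ) else -1) *
            echar Λ (-k') ((ℝ ∙ u)ᗮ.orthogonalProjectionOnto (q : EuclideanSpace ℝ (Fin 3))) = 0 := by
  classical
  intro k hk η T hT
  -- the index type of representatives, heights, window count
  haveI hR : Countable {q : EuclideanSpace ℝ (Fin 3) //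
      q ∈ Dp ∪ Dm ∧ (ℝ ∙ u)ᗮ.orthogonalProjectionOnto q ∈ fdom Λ} :=
    hbl_countable_signedReps Λ hδ hsepp hsepm
  have hy : ∀ q : {q : EuclideanSpace ℝ (Fin 3) //
      q ∈ Dp ∪ Dm ∧ (ℝ ∙ u)ᗮ.orthogonalProjectionOnto q ∈ fdom Λ},
      0 ≤ ⟪(q : EuclideanSpace ℝ (Fin 3)), u⟫ - a := by
    intro q
    rcases q.2.1 with h | h
    · linarith [hap _ h]
    · linarith [ham _ h]
  obtain ⟨N, hNc⟩ := hbl_exists_reps_height_count hu Λ hδ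
  have hN : ∀ j : ℕ, {q : {q : EuclideanSpace ℝ (Fin 3) //
      q ∈ Dp ∪ Dm ∧ (ℝ ∙ u)ᗮ.orthogonalProjectionOnto q ∈ fdom Λ} |
        (j : ℝ) ≤ ⟪(q : EuclideanSpace ℝ (Fin 3)), u⟫ - a ∧
          ⟪(q : EuclideanSpace ℝ (Fin 3)), u⟫ - a ≤ j + 1}.encard ≤ (N + N : ℕ) := by
    intro j
    set A := {q : {q : EuclideanSpace ℝ (Fin 3) //
      q ∈ Dp ∪ Dm ∧ (ℝ ∙ u)ᗮ.orthogonalProjectionOnto q ∈ fdom Λ} |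
        (j : ℝ) ≤ ⟪(q : EuclideanSpace ℝ (Fin 3)), u⟫ - a ∧
          ⟪(q : EuclideanSpace ℝ (Fin 3)), u⟫ - a ≤ j + 1} with hA
    have himg : (Subtype.val '' A) ⊆
        {q : EuclideanSpace ℝ (Fin 3) | (q ∈ Dp ∧ (ℝ ∙ u)ᗮ.orthogonalProjectionOnto q ∈ fdom Λ) ∧
          (a + j) ≤ ⟪q, u⟫ ∧ ⟪q, u⟫ ≤ (a + j) + 1} ∪
        {q : EuclideanSpace ℝ (Fin 3) | (q ∈ Dm ∧ (ℝ ∙ u)ᗮ.orthogonalProjectionOnto q ∈ fdom Λ) ∧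
          (a + j) ≤ ⟪q, u⟫ ∧ ⟪q, u⟫ ≤ (a + j) + 1} := by
      rintro x ⟨q, ⟨h1, h2⟩, rfl⟩
      rcases q.2.1 with h | h
      · exact Or.inl ⟨⟨h, q.2.2⟩, by linarith, by linarith⟩
      · exact Or.inr ⟨⟨h, q.2.2⟩, by linarith, by linarith⟩
    calc A.encard = (Subtype.val '' A).encard := (Subtype.val_injective.encard_image A).symm
      _ ≤ _ := Set.encard_le_encard himg
      _ ≤ _ := Set.encard_union_le _ _
      _ ≤ (N : ℕ∞) + N := add_le_add (hNc Dp hsepp (a + j)) (hNc Dm hsepm (a + j))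
      _ = ((N + N : ℕ) : ℕ∞) := by push_cast; rfl
  -- frequency data
  have hu0 : u ≠ 0 := by
    intro h0; rw [h0, norm_zero] at hu; exact zero_ne_one hu
  have hV : Module.finrank ℝ (ℝ ∙ u)ᗮ = 2 := hbl_finrank_orthogonal_span_singleton hu0
  obtain ⟨κ, hκ, hκle⟩ := hbl_exists_norm_dualVec_lb Λ
  have hρ0 : ‖dualVec Λ (0 : Fin (Module.finrank ℝ (ℝ ∙ u)ᗮ) → ℤ)‖ = 0 := by
    rw [hbl_dualVec_zero, norm_zero]
  have hρ : ∀ k : Fin (Module.finrank ℝ (ℝ ∙ u)ᗮ) → ℤ, k ≠ 0 → 0 < ‖dualVec Λ k‖ :=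
    fun k hk => hκ.trans_le (hκle k hk)
  have hexp : ∀ ε : ℝ, 0 < ε →
      Summable fun k : Fin (Module.finrank ℝ (ℝ ∙ u)ᗮ) → ℤ => Real.exp (-(ε * ‖dualVec Λ k‖)) :=
    fun ε hε => (summable_exp_neg_mul_norm_dualVec Λ hε).congr fun k => by ring_nf
  have hψ : ∀ k : Fin (Module.finrank ℝ (ℝ ∙ u)ᗮ) → ℤ, ‖echar Λ k b₀‖ = 1 := fun k => norm_echar Λ k _
  have hcn : 0 < ‖c‖ := norm_pos_iff.2 hc
  -- the weighted phases `θ' k q = ε_q e_{-k}(P q) ⟪c, w_k⟫ / (‖c‖ ‖w_k‖)`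
  have hθ : ∀ (k : Fin (Module.finrank ℝ (ℝ ∙ u)ᗮ) → ℤ)
      (q : {q : EuclideanSpace ℝ (Fin 3) //
        q ∈ Dp ∪ Dm ∧ (ℝ ∙ u)ᗮ.orthogonalProjectionOnto q ∈ fdom Λ}),
      ‖(if ((q : EuclideanSpace ℝ (Fin 3)) ∈ Dp) then (1 : ℂ) else -1) *
        echar Λ (-k) ((ℝ ∙ u)ᗮ.orthogonalProjectionOnto (q : EuclideanSpace ℝ (Fin 3))) *
        (((⟪c, dualVec Λ k⟫ / (‖c‖ * ‖dualVec Λ k‖) : ℝ)) : ℂ)‖ ≤ 1 := by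
    intro k q
    rw [norm_mul, norm_mul, norm_echar, mul_one, Complex.norm_real, Real.norm_eq_abs]
    have h1 : ‖(if ((q : EuclideanSpace ℝ (Fin 3)) ∈ Dp) then (1 : ℂ) else -1)‖ ≤ 1 := by
      split_ifs <;> simp
    have h2 : |⟪c, dualVec Λ k⟫ / (‖c‖ * ‖dualVec Λ k‖)| ≤ 1 := by
      by_cases hw : ‖dualVec Λ k‖ = 0
      · rw [hw, mul_zero, div_zero, abs_zero]; exact zero_le_one
      · rw [abs_div, abs_of_pos (by positivity : 0 < ‖c‖ * ‖dualVec Λ k‖), div_le_one (by positivity)]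
        exact abs_real_inner_le_norm c (dualVec Λ k)
    calc _ ≤ 1 * 1 := mul_le_mul h1 h2 (abs_nonneg _) zero_le_one
      _ = 1 := one_mul 1
  -- the coefficient functions of the horizontal profiles (after division by `-πi‖c‖`)
  have ha : ∀ r : ℝ, 0 < r → (fun r : ℝ => r * (Real.pi / 6 * (Real.pi * r) ^ 2)) r ≠ 0 := by
    intro r hr
    have : 0 < r * (Real.pi / 6 * (Real.pi * r) ^ 2) := by positivity
    exact this.ne'
  have hab : ∀ r : ℝ, 0 < r →
      |(fun r : ℝ => r * (Real.pi / 6 * (Real.pi * r) ^ 2)) r| ≤ Real.pi ^ 6 * Real.exp r ∧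
      |(fun r : ℝ => -(r * (Real.pi / 720 * (Real.pi * r) ^ 5))) r| ≤ Real.pi ^ 6 * Real.exp r := by
    intro r hr
    have hπ1 : (1 : ℝ) ≤ Real.pi := by linarith [Real.pi_gt_three]
    have h3 : r ^ 3 ≤ 6 * Real.exp r := by
      have h := Real.pow_div_factorial_le_exp r hr.le 3
      rw [div_le_iff₀ (by positivity)] at h
      have hf : ((Nat.factorial 3 : ℕ) : ℝ) = 6 := by norm_num [Nat.factorial]
      rw [hf] at h
      linarith
    have h6 : r ^ 6 ≤ 720 * Real.exp r := by
      have h := Real.pow_div_factorial_le_exp r hr.le 6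
      rw [div_le_iff₀ (by positivity)] at h
      have hf : ((Nat.factorial 6 : ℕ) : ℝ) = 720 := by norm_num [Nat.factorial]
      rw [hf] at h
      linarith
    have hπ3 : Real.pi ^ 3 ≤ Real.pi ^ 6 := pow_le_pow_right₀ hπ1 (by norm_num)
    have he : 0 < Real.exp r := Real.exp_pos r
    constructor
    · rw [abs_of_nonneg (by positivity)]
      calc r * (Real.pi / 6 * (Real.pi * r) ^ 2) = Real.pi ^ 3 / 6 * r ^ 3 := by ring
        _ ≤ Real.pi ^ 3 / 6 * (6 * Real.exp r) := by gcongr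
        _ = Real.pi ^ 3 * Real.exp r := by ring
        _ ≤ Real.pi ^ 6 * Real.exp r := by gcongr
    · rw [abs_neg, abs_of_nonneg (by positivity)]
      calc r * (Real.pi / 720 * (Real.pi * r) ^ 5) = Real.pi ^ 6 / 720 * r ^ 6 := by ring
        _ ≤ Real.pi ^ 6 / 720 * (720 * Real.exp r) := by gcongr
        _ = Real.pi ^ 6 * Real.exp r := by ring
  -- the normalising constant `C = -πi‖c‖`
  set C : ℂ := -(Real.pi * Complex.I * (‖c‖ : ℝ)) with hCdef
  have hC : C ≠ 0 := by
    rw [hCdef, neg_ne_zero]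
    refine mul_ne_zero (mul_ne_zero ?_ Complex.I_ne_zero) ?_
    · exact_mod_cast Real.pi_pos.ne'
    · exact_mod_cast hcn.ne'
  -- the mode sums vanish for `X > X₁`
  have hsum : ∀ X : ℝ, X₁ < X → HasSum (fun k : Fin (Module.finrank ℝ (ℝ ∙ u)ᗮ) → ℤ =>
      echar Λ k b₀ *
      ∑' q : {q : EuclideanSpace ℝ (Fin 3) //
          q ∈ Dp ∪ Dm ∧ (ℝ ∙ u)ᗮ.orthogonalProjectionOnto q ∈ fdom Λ},
        ((if ((q : EuclideanSpace ℝ (Fin 3)) ∈ Dp) then (1 : ℂ) else -1) *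
          echar Λ (-k) ((ℝ ∙ u)ᗮ.orthogonalProjectionOnto (q : EuclideanSpace ℝ (Fin 3))) *
          (((⟪c, dualVec Λ k⟫ / (‖c‖ * ‖dualVec Λ k‖) : ℝ)) : ℂ)) *
        (if k = 0 then
          (((0 : ℝ) * (-(Real.pi * ((X + (⟪(q : EuclideanSpace ℝ (Fin 3)), u⟫ - a))⁻¹ ^ 5 / 3 -
            (X + (⟪(q : EuclideanSpace ℝ (Fin 3)), u⟫ - a))⁻¹ ^ 11 / 6))) : ℝ) : ℂ)
        else
          (((fun r : ℝ => r * (Real.pi / 6 * (Real.pi * r) ^ 2)) ‖dualVec Λ k‖ *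
              (((X + (⟪(q : EuclideanSpace ℝ (Fin 3)), u⟫ - a)) ^ (-(2 : ℝ)) : ℝ) *
                ∫ w : ℝ, Real.exp (2 * w - 2 * Real.pi * ‖dualVec Λ k‖ *
                  (X + (⟪(q : EuclideanSpace ℝ (Fin 3)), u⟫ - a)) * Real.cosh w)) +
            (fun r : ℝ => -(r * (Real.pi / 720 * (Real.pi * r) ^ 5))) ‖dualVec Λ k‖ *
              (((X + (⟪(q : EuclideanSpace ℝ (Fin 3)), u⟫ - a)) ^ (-(5 : ℝ)) : ℝ) *
                ∫ w : ℝ, Real.exp (5 * w - 2 * Real.pi * ‖dualVec Λ k‖ *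
                  (X + (⟪(q : EuclideanSpace ℝ (Fin 3)), u⟫ - a)) * Real.cosh w)) :
            ℝ) : ℂ))) 0 := by
    intro X hX
    have hX0 : 0 < X := hX₁.trans hX
    have H := hbl_modes_hasSum_zero_of_zero hu Λ hδ hsepp hsepm hap ham hDp hDm
      (c : EuclideanSpace ℝ (Fin 3)) b₀ hX0 (hcol X hX)
    -- the slice of the `c`-component and its transform
    have hPc : (ℝ ∙ u)ᗮ.orthogonalProjectionOnto (c : EuclideanSpace ℝ (Fin 3)) = c :=
      Submodule.orthogonalProjectionOnto_mem_subspace_eq_self c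
    have hcu : ⟪(c : EuclideanSpace ℝ (Fin 3)), u⟫ = 0 := hbl_inner_coe_orthogonal u c
    have hterm : ∀ (kk : Fin (Module.finrank ℝ (ℝ ∙ u)ᗮ) → ℤ) (q : {q : EuclideanSpace ℝ (Fin 3) //
        q ∈ Dp ∪ Dm ∧ (ℝ ∙ u)ᗮ.orthogonalProjectionOnto q ∈ fdom Λ}),
        𝓕 (fun v : (ℝ ∙ u)ᗮ =>
          ((((⟪(ℝ ∙ u)ᗮ.orthogonalProjectionOnto (c : EuclideanSpace ℝ (Fin 3)), v⟫ +
                (-(X + (⟪(q : EuclideanSpace ℝ (Fin 3)), u⟫ - a))) *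
                  ⟪(c : EuclideanSpace ℝ (Fin 3)), u⟫) *
              ((‖v‖ ^ 2 + (-(X + (⟪(q : EuclideanSpace ℝ (Fin 3)), u⟫ - a))) ^ 2) ^ (-(4 : ℝ)) -
                (‖v‖ ^ 2 + (-(X + (⟪(q : EuclideanSpace ℝ (Fin 3)), u⟫ - a))) ^ 2) ^ (-(7 : ℝ)))) :
            ℝ) : ℂ)) (dualVec Λ kk) =
        (if kk = 0 then 0
        else
          -(Real.pi * Complex.I * (⟪c, dualVec Λ kk⟫ : ℝ)) *
            (((Real.pi / 6 * (Real.pi * ‖dualVec Λ kk‖) ^ 2) *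
                (((X + (⟪(q : EuclideanSpace ℝ (Fin 3)), u⟫ - a)) ^ (-(2 : ℝ)) : ℝ) *
                  ∫ w : ℝ, Real.exp (2 * w - 2 * Real.pi * ‖dualVec Λ kk‖ *
                    (X + (⟪(q : EuclideanSpace ℝ (Fin 3)), u⟫ - a)) * Real.cosh w)) -
              (Real.pi / 720 * (Real.pi * ‖dualVec Λ kk‖) ^ 5) *
                (((X + (⟪(q : EuclideanSpace ℝ (Fin 3)), u⟫ - a)) ^ (-(5 : ℝ)) : ℝ) *
                  ∫ w : ℝ, Real.exp (5 * w - 2 * Real.pi * ‖dualVec Λ kk‖ *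
                    (X + (⟪(q : EuclideanSpace ℝ (Fin 3)), u⟫ - a)) * Real.cosh w)) :
              ℝ) : ℂ)) := by
      intro kk q
      have ht : 0 < X + (⟪(q : EuclideanSpace ℝ (Fin 3)), u⟫ - a) :=
        add_pos_of_pos_of_nonneg hX0 (hy q)
      have hfun : (fun v : (ℝ ∙ u)ᗮ =>
          ((((⟪(ℝ ∙ u)ᗮ.orthogonalProjectionOnto (c : EuclideanSpace ℝ (Fin 3)), v⟫ +
                (-(X + (⟪(q : EuclideanSpace ℝ (Fin 3)), u⟫ - a))) *
                  ⟪(c : EuclideanSpace ℝ (Fin 3)), u⟫) *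
              ((‖v‖ ^ 2 + (-(X + (⟪(q : EuclideanSpace ℝ (Fin 3)), u⟫ - a))) ^ 2) ^ (-(4 : ℝ)) -
                (‖v‖ ^ 2 + (-(X + (⟪(q : EuclideanSpace ℝ (Fin 3)), u⟫ - a))) ^ 2) ^ (-(7 : ℝ)))) :
            ℝ) : ℂ)) =
          fun v : (ℝ ∙ u)ᗮ => (((⟪c, v⟫) *
            ((‖v‖ ^ 2 + (X + (⟪(q : EuclideanSpace ℝ (Fin 3)), u⟫ - a)) ^ 2) ^ (-(4 : ℝ)) -
              (‖v‖ ^ 2 + (X + (⟪(q : EuclideanSpace ℝ (Fin 3)), u⟫ - a)) ^ 2) ^ (-(7 : ℝ))) :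
            ℝ) : ℂ) := by
        funext v
        rw [hPc, hcu, neg_sq, mul_zero, add_zero]
      rw [hfun]
      by_cases hk0 : kk = 0
      · rw [if_pos hk0, hk0, hbl_dualVec_zero, hbl_fourier_horizontalSlice_zero hV ht]
      · have hw : dualVec Λ kk ≠ 0 := fun h0 => (hρ kk hk0).ne' (by rw [h0, norm_zero])
        rw [if_neg hk0, hbl_fourier_horizontalSlice hV ht c hw]
    -- `H` is the series of `C *` the normalised terms
    have H' : HasSum (fun k : Fin (Module.finrank ℝ (ℝ ∙ u)ᗮ) → ℤ => C * (echar Λ k b₀ *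
      ∑' q : {q : EuclideanSpace ℝ (Fin 3) //
          q ∈ Dp ∪ Dm ∧ (ℝ ∙ u)ᗮ.orthogonalProjectionOnto q ∈ fdom Λ},
        ((if ((q : EuclideanSpace ℝ (Fin 3)) ∈ Dp) then (1 : ℂ) else -1) *
          echar Λ (-k) ((ℝ ∙ u)ᗮ.orthogonalProjectionOnto (q : EuclideanSpace ℝ (Fin 3))) *
          (((⟪c, dualVec Λ k⟫ / (‖c‖ * ‖dualVec Λ k‖) : ℝ)) : ℂ)) *
        (if k = 0 then
          (((0 : ℝ) * (-(Real.pi * ((X + (⟪(q : EuclideanSpace ℝ (Fin 3)), u⟫ - a))⁻¹ ^ 5 / 3 -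
            (X + (⟪(q : EuclideanSpace ℝ (Fin 3)), u⟫ - a))⁻¹ ^ 11 / 6))) : ℝ) : ℂ)
        else
          (((fun r : ℝ => r * (Real.pi / 6 * (Real.pi * r) ^ 2)) ‖dualVec Λ k‖ *
              (((X + (⟪(q : EuclideanSpace ℝ (Fin 3)), u⟫ - a)) ^ (-(2 : ℝ)) : ℝ) *
                ∫ w : ℝ, Real.exp (2 * w - 2 * Real.pi * ‖dualVec Λ k‖ *
                  (X + (⟪(q : EuclideanSpace ℝ (Fin 3)), u⟫ - a)) * Real.cosh w)) +
            (fun r : ℝ => -(r * (Real.pi / 720 * (Real.pi * r) ^ 5))) ‖dualVec Λ k‖ *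
              (((X + (⟪(q : EuclideanSpace ℝ (Fin 3)), u⟫ - a)) ^ (-(5 : ℝ)) : ℝ) *
                ∫ w : ℝ, Real.exp (5 * w - 2 * Real.pi * ‖dualVec Λ k‖ *
                  (X + (⟪(q : EuclideanSpace ℝ (Fin 3)), u⟫ - a)) * Real.cosh w)) :
            ℝ) : ℂ)))) 0 := by
      refine H.congr_fun fun k' => ?_
      simp_rw [hterm k']
      by_cases hk0 : k' = 0
      · simp only [hk0, if_true, mul_zero, tsum_zero, zero_mul, Complex.ofReal_zero, zero_mul]
      · simp only [if_neg hk0]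
        rw [← tsum_mul_right, ← tsum_mul_left, ← tsum_mul_left]
        refine tsum_congr fun q => ?_
        have hρk : ((‖dualVec Λ k'‖ : ℝ) : ℂ) ≠ 0 := by exact_mod_cast (hρ k' hk0).ne'
        have hcne : ((‖c‖ : ℝ) : ℂ) ≠ 0 := by exact_mod_cast hcn.ne'
        rw [hCdef]
        push_cast
        field_simp
        ring
    have H'' := H'.mul_left C⁻¹
    rw [mul_zero] at H''
    refine H''.congr_fun fun k' => ?_
    rw [← mul_assoc, inv_mul_cancel₀ hC, one_mul]
  have core := hbl_shellSums_eq_zero_of_modeSum_eq_zero' (0 : Fin (Module.finrank ℝ (ℝ ∙ u)ᗮ) → ℤ)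
    (fun k => ‖dualVec Λ k‖) hρ0 hρ (fun C => finite_norm_dualVec_le Λ C) hexp
    (fun k => echar Λ k b₀) hψ
    (fun k (q : {q : EuclideanSpace ℝ (Fin 3) //
        q ∈ Dp ∪ Dm ∧ (ℝ ∙ u)ᗮ.orthogonalProjectionOnto q ∈ fdom Λ}) =>
      (if ((q : EuclideanSpace ℝ (Fin 3)) ∈ Dp) then (1 : ℂ) else -1) *
        echar Λ (-k) ((ℝ ∙ u)ᗮ.orthogonalProjectionOnto (q : EuclideanSpace ℝ (Fin 3))) *
        (((⟪c, dualVec Λ k⟫ / (‖c‖ * ‖dualVec Λ k‖) : ℝ)) : ℂ))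
    hθ (fun q => ⟪(q : EuclideanSpace ℝ (Fin 3)), u⟫ - a) hy hN 2 5 0
    (fun r : ℝ => r * (Real.pi / 6 * (Real.pi * r) ^ 2))
    (fun r : ℝ => -(r * (Real.pi / 720 * (Real.pi * r) ^ 5)))
    ha hab hX₁ hsum
  have h1 := core.2 k hk (η - a)
  -- identify the fibre Finset with `T`
  have hTeq : T = Finset.filter
      (fun q : {q : EuclideanSpace ℝ (Fin 3) //
        q ∈ Dp ∪ Dm ∧ (ℝ ∙ u)ᗮ.orthogonalProjectionOnto q ∈ fdom Λ} =>
        ⟪(q : EuclideanSpace ℝ (Fin 3)), u⟫ - a = η - a)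
      (hbl_shell_heights_finite hN hy (η - a)).toFinset := by
    ext q
    rw [hT q, Finset.mem_filter, Set.Finite.mem_toFinset, Set.mem_setOf_eq]
    constructor
    · intro h
      exact ⟨by rw [h], by rw [h]⟩
    · intro h
      linarith [h.2]
  rw [hTeq]
  -- multiply the normalised identity by `‖c‖ ‖w_k‖`
  have hρk : (‖dualVec Λ k‖ : ℝ) ≠ 0 := (hρ k hk).ne'
  have key := congrArg (fun z : ℂ => (((‖c‖ * ‖dualVec Λ k‖ : ℝ)) : ℂ) * z) h1
  simp only [mul_zero] at key
  rw [← key, Finset.mul_sum]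
  refine Finset.sum_congr rfl fun k' hk' => ?_
  have hnorm : ‖dualVec Λ k'‖ = ‖dualVec Λ k‖ := (Finset.mem_filter.1 hk').2
  rw [Finset.mul_sum, Finset.mul_sum, Finset.mul_sum]
  refine Finset.sum_congr rfl fun q _ => ?_
  rw [hnorm]
  have hc' : ((‖c‖ : ℝ) : ℂ) ≠ 0 := by exact_mod_cast hcn.ne'
  have hρ' : ((‖dualVec Λ k‖ : ℝ) : ℂ) ≠ 0 := by exact_mod_cast hρk
  push_cast
  field_simp

end Column

/-- **A clean column kills the weighted shell sums of the horizontal modes** (registered `∀`-form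
of `hbl_hshells_eq_zero_of_column'`). [folklore] -/
theorem hbl_hshells_eq_zero_of_column : ∀ {u : EuclideanSpace ℝ (Fin 3)} (hu : ‖u‖ = 1) (Λ : Submodule ℤ (ℝ ∙ u)ᗮ) [DiscreteTopology Λ] [IsZLattice ℝ Λ] {Dp Dm : Set (EuclideanSpace ℝ (Fin 3))} {δ a : ℝ} (hδ : 0 < δ), (∀ x ∈ Dp, ∀ y ∈ Dp, x ≠ y → δ ≤ dist x y) → (∀ x ∈ Dm, ∀ y ∈ Dm, x ≠ y → δ ≤ dist x y) → (∀ y ∈ Dp, a ≤ inner ℝ y u) → (∀ y ∈ Dm, a ≤ inner ℝ y u) → (∀ ℓ : Λ, ∀ y : EuclideanSpace ℝ (Fin 3), y + ((ℓ : (ℝ ∙ u)ᗮ) : EuclideanSpace ℝ (Fin 3)) ∈ Dp ↔ y ∈ Dp) → (∀ ℓ : Λ, ∀ y : EuclideanSpace ℝ (Fin 3), y + ((ℓ : (ℝ ∙ u)ᗮ) : EuclideanSpace ℝ (Fin 3)) ∈ Dm ↔ y ∈ Dm) → ∀ (b₀ : (ℝ ∙ u)ᗮ) (c : (ℝ ∙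 u)ᗮ), c ≠ 0 → ∀ {X₁ : ℝ}, 0 < X₁ → (∀ X : ℝ, X₁ < X → (∑' yy : ↥(Dp ∪ Dm), (if (yy : EuclideanSpace ℝ (Fin 3)) ∈ Dp then (1 : ℂ) else -1) * ((inner ℝ (c : EuclideanSpace ℝ (Fin 3)) (((((‖((b₀ : EuclideanSpace ℝ (Fin 3)) + (a - X) • u) - (yy : EuclideanSpace ℝ (Fin 3))‖ ^ 2) ^ 4)⁻¹ - ((‖((b₀ : EuclideanSpace ℝ (Fin 3)) + (a - X) • u) - (yy : EuclideanSpace ℝ (Fin 3))‖ ^ 2) ^ 7)⁻¹) • (((b₀ : EuclideanSpace ℝ (Fin 3)) + (a - X) • u) - (yy : EuclideanSpace ℝ (Fin 3))))) : ℝ) : ℂ)) = 0) → ∀ (k : Fin (Module.finrank ℝ (ℝ ∙ u)ᗮ) → ℤ), k ≠ 0 → ∀ (η : ℝ) (T : Finset {q : EuclideanSpace ℝ (Fin 3) // q ∈ Dp ∪ Dm ∧ (ℝ ∙ u)ᗮ.orthogonalProjectionOnto q ∈ Literature.Algebra.EuclideanLattices.LatticePeriodic.fdom Λ}), (∀ q,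 q ∈ T ↔ inner ℝ (q : EuclideanSpace ℝ (Fin 3)) u = η) → ∑ k' ∈ (Literature.Algebra.EuclideanLattices.LatticePeriodic.finite_norm_dualVec_le Λ ‖Literature.Algebra.EuclideanLattices.LatticePeriodic.dualVec Λ k‖).toFinset with ‖Literature.Algebra.EuclideanLattices.LatticePeriodic.dualVec Λ k'‖ = ‖Literature.Algebra.EuclideanLattices.LatticePeriodic.dualVec Λ k‖, Literature.Algebra.EuclideanLattices.LatticePeriodic.echar Λ k' b₀ * ((inner ℝ c (Literature.Algebra.EuclideanLattices.LatticePeriodic.dualVec Λ k') : ℝ) : ℂ) * ∑ q ∈ T, (if ((q : EuclideanSpace ℝ (Fin 3)) ∈ Dp) then (1 : ℂ) else -1) * Literature.Algebra.EuclideanLattices.LatticePeriodic.echar Λ (-k') ((ℝ ∙ u)ᗮ.orthogonalProjectionOnto (q : EuclideanSpace ℝ (Fin 3))) = 0 := by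
  intro u hu Λ _ _ Dp Dm δ a hδ hsepp hsepm hap ham hDp hDm b₀ c hc X₁ hX₁ hcol
  exact hbl_hshells_eq_zero_of_column' hu Λ hδ hsepp hsepm hap ham hDp hDm b₀ c hc hX₁ hcol

end Summit.AtomisticToContinuum.Crystallization.Theorems.HolmgrenBoyleLind

end
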